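import Mathlib.NumberTheory.Cyclotomic.Basic
import Literature.NumberTheory.EllipticCurves.Wuthrich2014.ReducibleDivisibilityCyclotomicThree
import HarnessLib

/-!
# Kato 2004, Thm. 17.4 (3) at `p = 3` (big `3`-adic image), read over `K = ℚ(ζ₃)`:
# `char_Λ X(E/ℚ(ζ_{3^∞})) ∣ L₃(E, ω⁰, T) · L₃(E, ω¹, T)` in `Λ`

Source: K. Kato, *`p`-adic Hodge theory and values of zeta functions of modular forms*, Astérisque
**295** (2004) 117–290 [Kato2004Asterisque], **Theorem 17.4 (3)** (p. 273), with §17.3 (p. 273: the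
Selmer group `Sel_∞(T) = lim_n Sel(ℚ(ζ_{p^n}), T(r))(−r)` over the full cyclotomic tower and its dual
`X(T)` as a module over `Λ = O_λ⟦G_∞⟧`), §12.1 (pp. 219–220: `G_∞ = Gal(ℚ(ζ_{p^∞})/ℚ)`,
`κ : G_∞ ≅ ℤ_p^×`, `Λ = O_λ⟦G_∞⟧`), Thm. 12.5 (4) (p. 222: condition (12.5.2)), §17.5 (pp. 273–274:
"good" `ω`, `γ`) and Thm. 16.2 (p. 269: the `p`-adic zeta function `L_{p-adic,α,ω,γ}(f)` and its
periods `per(ω) = Ω⁺γ⁺ + Ω⁻γ⁻`). ONE NAMED FACT (`def … : Prop`, nothing asserted, D-0014): the case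
`p = 3`, `f = f_E` of weight `2`, `F_λ = ℚ₃`, `T = T₃E(−1)`, of Theorem 17.4 (3), transcribed WITHOUT
any descent to the `ℤ₃`-extension of `ℚ` — the big-image SIBLING of
`Wuthrich2014.charIdeal_dvd_padicLFunction_cyclotomicThree` (same module shape, same conclusion;
Wuthrich's Thm. 16 is the `E[p]`-REDUCIBLE counterpart of Kato's 17.4 (3), whose hypothesis
(12.5.2) forces `E[p]` irreducible).

## The printed statements (held copy `paper:doi-10-24033-ast-639`, OCR-cleaned)

Thm. 17.4 (p. 273): "Assume `f` has good ordinary reduction at `λ`. Let `T` be a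
`Gal(ℚ̄/ℚ)`-stable `O_λ`-lattice of `V_{F_λ}(f)`. (1) `X(T)` is a torsion `Λ`-module. (2) Let `α` be as
in 17.1, let `ω` be a non-zero element of `S(f*)`, and let `γ` be an element of `V_F(f*)` such that
`γ⁺ ≠ 0` and `γ⁻ ≠ 0`. Then `L_{p-adic,α,ω,γ}(f) ∈ Λ ⊗ ℚ`, and we have
`length_{Λ_𝔭}(X(T)_𝔭) ≤ ord_𝔭(L_{p-adic,α,ω,γ}(f))` for any prime ideal `𝔭` in `Λ` of height one
which does not contain `p`. (3) Let `α, ω, γ` be as in (2), and assume that both `ω` and `γ` are good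
for some `Gal(ℚ̄/ℚ)`-stable `O_λ`-lattice of `V_{F_λ}(f)` in the sense of 17.5 below. Assume further
`p ≠ 2` and that the condition 12.5.2 in 12.5 (4) is satisfied. Then `L_{p-adic,α,ω,γ}(f)` belongs to
`Λ` and `length_{Λ_𝔭}(X(T)_𝔭) ≤ ord_𝔭(L_{p-adic,α,ω,γ}(f))` for any prime ideal `𝔭` of `Λ` of height
one." §17.3 (p. 273): "`Sel_∞(T) = lim_n Sel(ℚ(ζ_{p^n}), T(r))(−r)` … independent of `r`, and let
`X(T) = Hom_{O_λ}(Sel_∞(T), F_λ/O_λ)`. We regard `X(T)` as a module over `Λ = O_λ⟦G_∞⟧`."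
(12.5.2) (p. 222): "There exists an `O_λ`-basis of `T` for which the image of the homomorphism
`Gal(ℚ̄/ℚ(ζ_{p^∞})) → GL_{O_λ}(T) ≅ GL₂(O_λ)` contains `SL₂(ℤ_p)`." §17.5 (p. 274): "In the case `f`
of weight `2` and `T = (T_pE)(−1)` for an elliptic curve `E` over `ℚ`, `ω` is good for `T` if and
only if `ω` is a `ℤ_p`-basis of `coLie(𝓔) ⊗ ℤ_p` where `𝓔` is the Néron model of `E`"; (14.18)
"`γ` is good for `T` if `γ⁺` is an `O_λ`-basis of `T⁺` and `γ⁻` is an `O_λ`-basis of `T⁻`."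

## The reading (why this transcription is verbatim up to semisimple bookkeeping) — IDENTICAL to the
## reading of `Wuthrich2014.charIdeal_dvd_padicLFunction_cyclotomicThree` (flag `Wu14-Thm16-p3-branch-split`)

For `E/ℚ` and `p = 3` good ordinary: `F_λ = ℚ₃`, `O_λ = ℤ₃`, `T = T₃E(−1)`, `r = 1`, so
`Sel(ℚ(ζ_{3^n}), T(1)) = Sel_{3^∞}(E/ℚ(ζ_{3^n}))` (Kato §14.1: the classical Selmer group of `T₃E`) and
`X(T)` is the Pontryagin dual of `Sel_{3^∞}(E/ℚ(ζ_{3^∞}))` as a `Λ = ℤ₃⟦G_∞⟧`-module,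
`G_∞ = Gal(ℚ(ζ_{3^∞})/ℚ) ≅ ℤ₃^× = Δ × Γ`, `Δ = {±1}`. **Take `K := ℚ(ζ₃) = ℚ(√−3)`**: the fields
`ℚ(ζ_{3^{n+1}})` are exactly the layers of the cyclotomic `ℤ₃`-extension `K_∞ = ℚ(ζ_{3^∞})` of the
NUMBER FIELD `K`, so `X(T) = X(E/K_∞)` IS the tree's `WeierstrassCurve.SelmerDualData` of (any
`K`-model `V'` of) `E_K` for `κ : ZpExtension K 3` cyclotomic, `T = γ − 1`, `χ₃(γ) = 4 = 1 + 3`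
(`cyclotomicGenerator 3`). `Λ(G_∞) = Λ(Γ)e₊ ⊕ Λ(Γ)e₋` (`3 ∤ #Δ`); the height-one primes of `Λ(G_∞)`
are those of the two factors, so "`length_{Λ_𝔭}(X(T)_𝔭) ≤ ord_𝔭(L)` for every height-one `𝔭`" says
`char_{Λ(Γ)}(e_±X) ∣ e_±L` in `Λ(Γ)` (a UFD), whence — characteristic ideals being multiplicative
over `X = e₊X ⊕ e₋X` — `char_{Λ(Γ)} X(E/K_∞) ∋ (e₊L)·(e₋L)`. The components `e_±L` of Kato's
`L_{p-adic,α,ω,γ}(f) ∈ Λ(G_∞)` (Thm. 16.2: the measure interpolating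
`G(χ,ζ_{p^n}) α^{−n} L(f,χ̄,1)/Ω^±`, `per(ω) = Ω⁺γ⁺ + Ω⁻γ⁻`; for `ω` = Néron differential and `γ`
good, `Ω^±` are the Néron periods of `E` up to `ℤ₃^×` and signs) are the two tame branches of the
Mazur–Swinnerton-Dyer measure: `e₊L ↔ L₃(E,ω⁰,T)` (tree `padicLFunction`) and
`e₋L ↔ L₃(E,ω¹,T)` (odd branch on the MINUS modular symbols, Mazur–Tate–Teitelbaum 1986 §I.13;
tree `padicLFunctionMinusBranch … 1`). Period normalisation (the only translation made, exactly as in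
the Wuthrich sibling and in the tree's `kato_divisibility`): with `ϖ⁺·Ω_E = Ω⁺_f`,
`ϖ⁻·|Ω⁻(E)| = Ω⁻_f` (`plusPeriod f`, `minusPeriod f`; `realPeriodRat`, `imaginaryPeriodRat`) the
Néron-normalised product is `u·ϖ⁺ϖ⁻·padicLFunction f α·padicLFunctionMinusBranch f α 1` for a
`3`-adic unit `u` (signs, `c_∞ ∈ {1,2}`, powers of `2`), kept as an explicit unit.

Hypotheses transcribed: `E = V` globally minimal over `ℚ`, good ordinary at `3` (`IsOrdinaryAt V 3`,
= 17.1 (i): `p ∤ N`, `a_p ∈ O_λ^×`); `p = 3 ≠ 2`; (12.5.2) as "`ρ̄_{E,3^n} : Γ_ℚ → GL₂(ℤ/3^n)` is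
surjective for every `n`" (`∀ n, V.HasSurjectiveModNGaloisRep (3^n)` — the tree's spelling of
"`ρ_{E,3}` onto `GL₂(ℤ₃)`", as in `kato_divisibility` clause 3; it implies (12.5.2) because
`det ρ = χ₃` cuts out `ℚ(ζ_{3^∞})`, so the image of `Gal(ℚ̄/ℚ(ζ_{3^∞}))` is `ρ(Γ_ℚ) ∩ SL₂(ℤ₃) = SL₂(ℤ₃)`);
`ω`, `γ` good (a CHOICE, always possible: 17.5 "Note that a good `ω` for `T` exists") — absorbed in
the period normalisation above; `K` a cyclotomic extension `{3}` of `ℚ`, `V'` any `K`-model of `E_K`,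
`κ` the cyclotomic `ℤ₃`-extension of `K` with topological generator `γ`, `χ₃(γ)·ζ = 4` with `ζ`
torsion, `f` the newform of `E`, `α = unitRoot V 3`, `D` a Pontryagin-dual datum of
`Sel_{3^∞}(E/K_∞)`. Conclusion: `X(E/K_∞)` is `Λ`-torsion (17.4 (1)) and
`u ϖ⁺ϖ⁻ · L₃(E,ω⁰,T) L₃(E,ω¹,T) = ι g` for some `g ∈ char_{Λ(Γ)} X(E/K_∞)`, `u ∈ ℤ₃^×`.

What is NOT here: `p ≠ 3`; (12.5.2) in its printed generality (image of `Gal(ℚ̄/ℚ(ζ_{p^∞}))`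
CONTAINS `SL₂(ℤ_p)`); modular forms of weight `k > 2` or with coefficients; any proof (Kato's Euler
system is not in Mathlib). No `_holds` is to be expected.
-- TODO(general form): Thm. 17.4 (3) for every odd `p` over `K = ℚ(μ_p)` (product over all `p − 1`
-- branches), for lattices `T ⊂ V_{F_λ}(f)` of any ordinary newform `f` of weight `k ≥ 2`, under
-- (12.5.2) "the image of `Gal(ℚ̄/ℚ(ζ_{p^∞}))` contains `SL₂(ℤ_p)`".

Consumer: the BSD rank-≤1 residual cell (`b2b-bsdres`, sub-cell additive-p4, line V14b): with
Greenberg's Euler-characteristic formula over `K` (`Greenberg1999.thm41_charValue_rankZero_numberField`)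
and Milne's Weil-restriction identity this fact bounds `#Ш(E/ℚ)[3^∞] · #Ш(E^{(−3)}/ℚ)[3^∞]` for the
ADDITIVE twist `E^{(−3)}` with `E[3]` IRREDUCIBLE (class X4 at `p = 3`) without any descent
`X(E^{(−3)}/ℚ_∞) ≅ X(E/ℚ(μ_{3^∞}))^{(ω)}`.
-/

set_option autoImplicit false

noncomputable section

open scoped Classical MatrixGroups ModularForm

open CongruenceSubgroup WeierstrassCurve Literature.NumberTheory.EllipticCurves
  Literature.NumberTheory.EllipticCurves.ModularForms
  Literature.NumberTheory.GaloisRepresentations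

namespace Literature.NumberTheory.EllipticCurves.Kato2004

/-- **Kato 2004, Theorem 17.4 (3) at `p = 3` under `ρ_{E,3^∞}` onto, read over `K = ℚ(ζ₃)`:
`char_{Λ(Γ)} X(E/ℚ(ζ_{3^∞})) ∋ u · L₃(E, ω⁰, T) · L₃(E, ω¹, T)`.** As printed (Astérisque 295,
Thm. 17.4, p. 273): "Assume `f` has good ordinary reduction at `λ`. Let `T` be a `Gal(ℚ̄/ℚ)`-stable
`O_λ`-lattice of `V_{F_λ}(f)`. (1) `X(T)` is a torsion `Λ`-module. […] (3) Let `α, ω, γ` be as in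
(2), and assume that both `ω` and `γ` are good […] in the sense of 17.5 below. Assume further
`p ≠ 2` and that the condition 12.5.2 in 12.5 (4) is satisfied. Then `L_{p-adic,α,ω,γ}(f)` belongs
to `Λ` and `length_{Λ_𝔭}(X(T)_𝔭) ≤ ord_𝔭(L_{p-adic,α,ω,γ}(f))` for any prime ideal `𝔭` of `Λ` of
height one" — with `Λ = O_λ⟦Gal(ℚ(ζ_{p^∞})/ℚ)⟧` (§12.1, §17.3), `X(T)` the dual of
`lim_n Sel(ℚ(ζ_{p^n}), T(r))(−r)` (§17.3) and (12.5.2) (p. 222) "the image of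
`Gal(ℚ̄/ℚ(ζ_{p^∞})) → GL₂(O_λ)` contains `SL₂(ℤ_p)`". For `E/ℚ`, `p = 3`, `T = T₃E(−1)`: the tower
`ℚ(ζ_{3^{n+1}})` is the cyclotomic `ℤ₃`-extension `K_∞` of `K = ℚ(ζ₃)`, so `X(T) = X(E/K_∞)` is
the tree's Iwasawa module of (any `K`-model `V'` of) `E_K` for `κ : ZpExtension K 3` cyclotomic,
`T = γ − 1`, `χ₃(γ) = 4`; `Λ = Λ(Γ)e₊ ⊕ Λ(Γ)e₋` (`Δ = {±1}`) and the printed inequality at every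
height-one prime says `char(e_±X) ∣ e_±L` in `Λ(Γ)`, whence `char_{Λ(Γ)} X(E/K_∞) ∋ e₊L · e₋L =
L₃(E,ω⁰,T)·L₃(E,ω¹,T)`, the two tame branches of the Néron-normalised Mazur–Swinnerton-Dyer measure
(Thm. 16.2 with `ω` Néron, `γ` good; Mazur–Tate–Teitelbaum 1986 §I.13: even branch on `[·]⁺`, odd
branch on `[·]⁻`). In the tree's normalisation by the newform periods (`ϖ·Ω_E = Ω⁺_f`,
`ϖ'·|Ω⁻(E)| = Ω⁻_f`): `X(E/K_∞)` is `Λ`-torsion and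
`u·ϖϖ'·padicLFunction f α·padicLFunctionMinusBranch f α 1 = ι g` for some `g ∈ char_Λ X(E/K_∞)` and
a unit `u ∈ ℤ₃^×`, `α = unitRoot V 3`, `ι = iwasawaToPowerSeries 3`. (12.5.2) is transcribed by the
stronger "`ρ̄_{E,3^n}` surjective for all `n`" (as in the tree's `kato_divisibility`, clause 3).
Same module shape and conclusion as the reducible sibling
`Wuthrich2014.charIdeal_dvd_padicLFunction_cyclotomicThree`; named fact, nothing asserted.
**RETIRED as a separate named fact (cell `b2b-bsdres`, referee ruling R120.2, 2026-08-20, endorsing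
lit C175 (ii); deprecate-and-add):** this `p = 3`, `F = K` special case is a KERNEL CONSEQUENCE of the
odd-`p` reading `Kato2004.charIdeal_dvd_padicLFunction_cyclotomicPrime_of_surjective`
(`BigImageDivisibilityCyclotomicPrime.lean`, p228429) — derivation
`Kato2004.charIdeal_dvd_padicLFunction_cyclotomicThree_of_surjective_of_cyclotomicPrime`
(`BigImageDivisibilityCyclotomicThreeOfPrime.lean`, p238202); the cell's class-level consumers were
re-based on the odd-`p` readings in
`Summits/BirchSwinnertonDyer/Rank1Residual/Additive/SemistableTwistRankZeroThreeClassOfPrime.lean`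
(p238590). New consumers take the general fact; existing consumers migrate to the `…OfPrime` form
when next touched; this `def` is kept verbatim only until no module references it, then removed.
[cite: Kato2004Asterisque, Thm. 17.4 (3) (p. 273) with §17.3 (p. 273), Thm. 12.5 (4) (12.5.2) (p. 222), §17.5 (p. 274), Thm. 16.2 (p. 269), §12.1 (p. 219)]
[cite: MazurTateTeitelbaum1986Invent, §I.13] -/
def charIdeal_dvd_padicLFunction_cyclotomicThree_of_surjective : Prop :=
  ∀ (V : WeierstrassCurve ℚ) [V.IsElliptic] [V.IsGloballyMinimal]
    (K : Type) [Field K] [NumberField K] [IsCyclotomicExtension {3} ℚ K]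
    (V' : WeierstrassCurve K) [V'.IsElliptic]
    {κ : ZpExtension K 3} {γ : Field.absoluteGaloisGroup K} {N : ℕ} [NeZero N]
    {f : CuspForm (Gamma0 N) 2},
    IsOrdinaryAt V 3 → (∀ n : ℕ, V.HasSurjectiveModNGaloisRep (3 ^ n : ℕ)) →
    (∃ C : VariableChange K, C • V.baseChange K = V') →
    κ.IsCyclotomic → κ.IsTopGenerator γ →
    (∃ ζ : ℤ_[3]ˣ, IsOfFinOrder ζ ∧
      ((GaloisRep.cyclotomicCharacter K 3 γ * ζ : ℤ_[3]ˣ) : ℤ_[3]) =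
        (cyclotomicGenerator 3 : ℤ_[3])) →
    IsNewformOf V f →
    ∀ (D : V'.SelmerDualData κ γ) (ϖ ϖ' : ℚ),
      (ϖ : ℝ) * V.realPeriodRat = plusPeriod f →
      (ϖ' : ℝ) * V.imaginaryPeriodRat = minusPeriod f →
      D.IsTorsion ∧
      ∃ g ∈ D.charIdeal, ∃ u : ℤ_[3]ˣ,
        iwasawaToPowerSeries 3 g =
          PowerSeries.C (((u : ℤ_[3]) : ℚ_[3]) * (ϖ : ℚ_[3]) * (ϖ' : ℚ_[3])) *
            (padicLFunction f ((unitRoot V 3 : ℤ_[3]) : ℚ_[3]) *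
              padicLFunctionMinusBranch f ((unitRoot V 3 : ℤ_[3]) : ℚ_[3]) 1)

end Literature.NumberTheory.EllipticCurves.Kato2004

end
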